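import Mathlib
import Summits.Ventures.PercRepro2.Defs
import Summits.Ventures.PercRepro2.Independence
import Summits.Ventures.PercRepro2.Graph
import Summits.Ventures.PercRepro2.Exploration
import Summits.Ventures.PercRepro2.Induced
import Summits.Ventures.PercRepro2.R2PrimeThreeReduction
import Summits.Ventures.PercRepro2.YBridge
import Summits.Ventures.PercRepro2.HCov
import Summits.Ventures.PercRepro2.HubModel
import Summits.Ventures.PercRepro2.HubLaw
import Summits.Ventures.PercRepro2.HubRootLaw
import Summits.Ventures.PercRepro2.HubConn
import Summits.Ventures.PercRepro2.HubBernstein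
import Summits.Ventures.PercRepro2.HubGc
import Summits.Ventures.PercRepro2.HubKron
import Summits.Ventures.PercRepro2.HubCert
import Summits.Ventures.PercRepro2.HubCertPart1
import Summits.Ventures.PercRepro2.HubCertPart2
import Summits.Ventures.PercRepro2.HubCertPart3
import Summits.Ventures.PercRepro2.HubCertPart4
import Summits.Ventures.PercRepro2.HubCertPart5
import Summits.Ventures.PercRepro2.HubCertPart6

import Summits.Ventures.PercRepro2.HubCertAll

/-!
# The kernel check of the hub certificates, first index `0`
(blind cell PercRepro2, typer-1 g8; HUB-LEAN-SCOPE.md (S4), kernel route)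

`hub_check_0`: for the 25 atom triples `(0, b, d)` the doubled symmetrised Kronecker hub number
equals the Kronecker number of the symmetrised certificates — one `decide +kernel` (big-integer
arithmetic, no `native_decide`).
-/

namespace Summit.Ventures.PercRepro2.Hub

set_option maxHeartbeats 0 in
set_option maxRecDepth 100000 in
/-- **The kernel check, first index `0`.** -/
theorem hub_check_0 : ∀ b d : Fin 5, 2 * kronSym 0 b d = certNum 0 b d := by
  decide +kernel

end Summit.Ventures.PercRepro2.Hub
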